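import Summits.AtomisticToContinuum.Crystallization.Theorems.SpectralChargeLedgerShellsToLayersGoodOfLimit
import Summits.AtomisticToContinuum.Crystallization.Theorems.HullExactificationCascadeExactHcpLocalTheoremExactify

/-!
# `SpectralChargeLedger.ShellsToLayers` (stmt-AtomisticToContinuum-17254), line `blowup-slot-layering` —
# stub S2 `stub_exactOfForallGood`: `∀ η > 0`-goodness is exactness (both letters)

Helper file for the crux `ShellsToLayers` of route `SpectralChargeLedger` (supports
stmt-AtomisticToContinuum-17254; proves the registered stub `stub_exactOfForallGood` of the line
`Cruxes/ShellsToLayers/Lines/blowup_slot_layering.lean` verbatim).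

A point `p` of a set `Y ⊆ ℝ³` whose punctured open `13/10·a₀`-shell is, for EVERY `η > 0`,
`η`-congruent (linear isometry + bijection, pointwise) to the punctured open `13/10·a₀`-shell of the
origin in `hcpStacking a₀ h₀` or in `fccStacking a₀ h₀` (the letter may depend on `η`) has an EXACT
template shell: `shell = p + A(template)` for a linear isometry `A` and one of the two letters.

* `exists_isometry_of_gram_frame` — pattern-generic form of `ExactHcpLocal.exists_isometry_of_gram`:
  a map preserving inner products on a set `P ⊆ ℝ³` containing a linearly independent triple agrees
  on `P` with a linear isometry;
* `shell_eq_image_of_forall_eta` — pattern-generic form of `ExactHcpLocal.exact_cluster` (punctured):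
  `∀ η`-congruence of `T` to a finite pattern `P` containing a frame gives `T = y + B(P)`
  (`exists_equiv_forall_eta`: one bijection serves every `η`; `inner_eq_of_forall_eta`: Gram
  matrices agree; then the frame lemma);
* `frame_mem_shells` — the frame `u, v, w + h₀e₃` (`barlowPos a₀ h₀ alternatingHagg 0 1 0 / 0 0 1 /
  1 0 0`, `linearIndependent_frame`) lies in BOTH template shells on the box (layers `0` and `1` of
  the alternating and the constant Hägg word carry the same labels);
* `stub_exactOfForallGood` — the registered stub: one letter recurs for arbitrarily small `η`
  (congruence is monotone in `η`), then `shell_eq_image_of_forall_eta` for that letter.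

All `[folklore]` (rigidity of finite point configurations from Gram data). No definitions.
-/

noncomputable section

namespace Summit.AtomisticToContinuum.Crystallization.Theorems.ShellsToLayers

open Metric
open Literature.MathematicalPhysics.StatisticalMechanics
open Summit.AtomisticToContinuum.Crystallization.Theorems.ExactHcpLocal

section Exactify

open RealInnerProductSpace

/-- **A linear isometry from Gram data on a frame** (pattern-generic form of
`ExactHcpLocal.exists_isometry_of_gram`): a map `φ` preserving inner products on a set `P` that
contains a linearly independent triple agrees on `P` with a linear isometry equivalence of `ℝ³`.
[folklore] -/
theorem exists_isometry_of_gram_frame {P : Set (EuclideanSpace ℝ (Fin 3))}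
    (f : Fin 3 → EuclideanSpace ℝ (Fin 3)) (hf : LinearIndependent ℝ f) (hfP : ∀ i, f i ∈ P)
    (φ : EuclideanSpace ℝ (Fin 3) → EuclideanSpace ℝ (Fin 3))
    (hφ : ∀ p ∈ P, ∀ q ∈ P, ⟪φ p, φ q⟫ = ⟪p, q⟫) :
    ∃ B : EuclideanSpace ℝ (Fin 3) ≃ₗᵢ[ℝ] EuclideanSpace ℝ (Fin 3), ∀ p ∈ P, B p = φ p := by
  let b : Module.Basis (Fin 3) ℝ (EuclideanSpace ℝ (Fin 3)) :=
    basisOfLinearIndependentOfCardEqFinrank hf (by simp)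
  have hb : ⇑b = f := coe_basisOfLinearIndependentOfCardEqFinrank _ _
  set L : EuclideanSpace ℝ (Fin 3) →ₗ[ℝ] EuclideanSpace ℝ (Fin 3) := b.constr ℝ fun i => φ (f i)
    with hL
  have hLb : ∀ i, L (b i) = φ (f i) := fun i => by rw [hL, Module.Basis.constr_basis]
  have hLq : ∀ x, ∀ q ∈ P, ⟪L x, φ q⟫ = ⟪x, q⟫ := by
    intro x q hq
    conv_lhs => rw [← b.sum_repr x]
    conv_rhs => rw [← b.sum_repr x]
    simp only [map_sum, map_smul, sum_inner, inner_smul_left, hLb]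
    refine Finset.sum_congr rfl fun i _ => ?_
    rw [hφ _ (hfP i) _ hq, hb]
  have hLL : ∀ x x', ⟪L x, L x'⟫ = ⟪x, x'⟫ := by
    intro x x'
    conv_lhs => rw [← b.sum_repr x']
    conv_rhs => rw [← b.sum_repr x']
    simp only [map_sum, map_smul, inner_sum, inner_smul_right, hLb]
    refine Finset.sum_congr rfl fun i _ => ?_
    rw [hLq x _ (hfP i), hb]
  set B₀ := L.isometryOfInner hLL with hB₀
  refine ⟨B₀.toLinearIsometryEquiv rfl, fun p hp => ?_⟩
  rw [LinearIsometry.toLinearIsometryEquiv_apply, hB₀, LinearMap.coe_isometryOfInner]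
  have h0 : ⟪L p - φ p, L p - φ p⟫ = 0 := by
    rw [inner_sub_left, inner_sub_right, inner_sub_right, hLL, hLq p p hp, real_inner_comm (L p) (φ p),
      hLq p p hp, hφ p hp p hp]
    ring
  rw [real_inner_self_eq_norm_sq] at h0
  have : ‖L p - φ p‖ = 0 := by nlinarith [norm_nonneg (L p - φ p)]
  exact sub_eq_zero.1 (norm_eq_zero.1 this)

/-- **Exactification for a finite pattern containing a frame** (pattern-generic form of
`ExactHcpLocal.exact_cluster`, punctured statement): if `T` is `η`-congruent to `P` for every
`η > 0` (linear isometry + bijection), all points of `T` are within `r` of `y`, all points of `P`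
have norm `< r`, and `P` contains a linearly independent triple, then `T = y + B(P)` for a linear
isometry `B`. [folklore] -/
theorem shell_eq_image_of_forall_eta {T P : Set (EuclideanSpace ℝ (Fin 3))} (hPfin : P.Finite)
    {y : EuclideanSpace ℝ (Fin 3)} {r : ℝ} (hr : 0 < r)
    (hTr : ∀ t ∈ T, dist t y < r) (hPr : ∀ q ∈ P, ‖q‖ < r)
    (f : Fin 3 → EuclideanSpace ℝ (Fin 3)) (hf : LinearIndependent ℝ f) (hfP : ∀ i, f i ∈ P)
    (hloc : ∀ η : ℝ, 0 < η → ∃ A : EuclideanSpace ℝ (Fin 3) →ₗᵢ[ℝ] EuclideanSpace ℝ (Fin 3),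
      ∃ e : ↥T ≃ ↥P, ∀ t : ↥T,
        dist ((t : EuclideanSpace ℝ (Fin 3)) - y) (A ((e t : ↥P) : EuclideanSpace ℝ (Fin 3))) ≤ η) :
    ∃ B : EuclideanSpace ℝ (Fin 3) →ₗᵢ[ℝ] EuclideanSpace ℝ (Fin 3),
      T = (fun q => y + B q) '' P := by
  classical
  haveI : Finite ↥P := hPfin.to_subtype
  obtain ⟨e, he⟩ := exists_equiv_forall_eta hloc
  have gram := inner_eq_of_forall_eta hr (T := T) (P := P) (y := y)
    (fun t => by rw [← dist_eq_norm]; exact le_of_lt (hTr t t.2)) (fun p => le_of_lt (hPr p p.2))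
    e he
  set φ : EuclideanSpace ℝ (Fin 3) → EuclideanSpace ℝ (Fin 3) := fun p =>
    if hp : p ∈ P then ((e.symm ⟨p, hp⟩ : ↥T) : EuclideanSpace ℝ (Fin 3)) - y else 0 with hφdef
  have hφ : ∀ p (hp : p ∈ P), φ p = ((e.symm ⟨p, hp⟩ : ↥T) : EuclideanSpace ℝ (Fin 3)) - y := by
    intro p hp; rw [hφdef]; simp only [dif_pos hp]
  have hφgram : ∀ p ∈ P, ∀ q ∈ P, ⟪φ p, φ q⟫ = ⟪p, q⟫ := by
    intro p hp q hq
    rw [hφ p hp, hφ q hq, gram]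
    simp
  obtain ⟨B, hB⟩ := exists_isometry_of_gram_frame f hf hfP φ hφgram
  refine ⟨B.toLinearIsometry, Set.Subset.antisymm ?_ ?_⟩
  · intro x hxT
    set q := e ⟨x, hxT⟩ with hq
    refine ⟨(q : EuclideanSpace ℝ (Fin 3)), q.2, ?_⟩
    show y + B q = x
    rw [hB _ q.2, hφ _ q.2]
    have : e.symm ⟨(q : EuclideanSpace ℝ (Fin 3)), q.2⟩ = ⟨x, hxT⟩ := by
      rw [Subtype.coe_eta, hq, e.symm_apply_apply]
    rw [this]; abel
  · rintro x ⟨n, hn, rfl⟩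
    have e1 : y + B n = ((e.symm ⟨n, hn⟩ : ↥T) : EuclideanSpace ℝ (Fin 3)) := by
      rw [hB n hn, hφ n hn]; abel
    show y + B n ∈ T
    rw [e1]
    exact (e.symm ⟨n, hn⟩).2

end Exactify

/-- **The frame lies in both template shells.** On the box the three sites `u = barlowPos a₀ h₀ alt 0 1 0`,
`v = … 0 0 1`, `w + h₀e₃ = … 1 0 0` are linearly independent and belong to the punctured open
`13/10·a₀`-shell of the origin in `hcpStacking a₀ h₀` AND in `fccStacking a₀ h₀` (layers `0`, `1` of the
alternating and of the constant word carry the labels `0`, `1`). [folklore] -/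
theorem frame_mem_shells {a₀ h₀ : ℝ} (ha : 47 / 50 ≤ a₀) (hh : |h₀ - a₀ * Real.sqrt (2 / 3)| ≤ a₀ / 100) :
    LinearIndependent ℝ ![barlowPos a₀ h₀ alternatingHagg 0 1 0, barlowPos a₀ h₀ alternatingHagg 0 0 1,
        barlowPos a₀ h₀ alternatingHagg 1 0 0] ∧
    (∀ i : Fin 3, ![barlowPos a₀ h₀ alternatingHagg 0 1 0, barlowPos a₀ h₀ alternatingHagg 0 0 1,
        barlowPos a₀ h₀ alternatingHagg 1 0 0] i ∈
      {q : EuclideanSpace ℝ (Fin 3) | q ∈ hcpStacking a₀ h₀ ∧ q ≠ 0 ∧ ‖q‖ < 13 / 10 * a₀}) ∧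
    (∀ i : Fin 3, ![barlowPos a₀ h₀ alternatingHagg 0 1 0, barlowPos a₀ h₀ alternatingHagg 0 0 1,
        barlowPos a₀ h₀ alternatingHagg 1 0 0] i ∈
      {q : EuclideanSpace ℝ (Fin 3) | q ∈ fccStacking a₀ h₀ ∧ q ≠ 0 ∧ ‖q‖ < 13 / 10 * a₀}) := by
  obtain ⟨ha0, hlo, hhi⟩ := inBox_bounds ha hh
  have hh0 : 0 < h₀ := by linarith
  have hh1 : 64 / 100 * a₀ ^ 2 < h₀ ^ 2 := by nlinarith
  have hh2 : h₀ ^ 2 < 69 / 100 * a₀ ^ 2 := by nlinarith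
  have hL1 : haggLabel alternatingHagg 1 = 1 := haggLabel_alternating_of_odd odd_one
  -- the three hcp sites: non-zero, short
  have hne : ∀ k i j : ℤ, ¬ (k = 0 ∧ i = 0 ∧ j = 0) → barlowPos a₀ h₀ alternatingHagg k i j ≠ 0 := by
    intro k i j hne h0
    rw [← barlowPos_alternating_zero a₀ h₀] at h0
    exact hne (site_inj ha0.ne' hh0.ne' h0)
  have memH : ∀ k i j : ℤ, ((k = 0 ∧ -1 ≤ i ∧ i ≤ 1 ∧ -1 ≤ j ∧ j ≤ 1 ∧ -1 ≤ i + j ∧ i + j ≤ 1) ∨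
      ((k = 1 ∨ k = -1) ∧ -1 ≤ i ∧ i ≤ 0 ∧ -1 ≤ j ∧ j ≤ 0 ∧ -1 ≤ i + j)) →
      ¬ (k = 0 ∧ i = 0 ∧ j = 0) →
      barlowPos a₀ h₀ alternatingHagg k i j ∈
        {q : EuclideanSpace ℝ (Fin 3) | q ∈ hcpStacking a₀ h₀ ∧ q ≠ 0 ∧ ‖q‖ < 13 / 10 * a₀} :=
    fun k i j hL hn => ⟨barlowPos_mem _ _ _, hne k i j hn, (norm_site_lt_iff ha0 hh1 hh2 k i j).2 hL⟩
  -- the same three points are fcc sites (labels of layers `0` and `1` agree)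
  have hcf : ∀ i j : ℤ, ∀ k : ℤ, (k = 0 ∨ k = 1) →
      barlowPos a₀ h₀ alternatingHagg k i j = barlowPos a₀ h₀ constHagg k i j := by
    intro i j k hk
    rcases hk with rfl | rfl
    · simp [barlowPos]
    · simp [barlowPos, hL1]
  have memF : ∀ k i j : ℤ, (k = 0 ∨ k = 1) →
      barlowPos a₀ h₀ alternatingHagg k i j ∈
        {q : EuclideanSpace ℝ (Fin 3) | q ∈ hcpStacking a₀ h₀ ∧ q ≠ 0 ∧ ‖q‖ < 13 / 10 * a₀} →
      barlowPos a₀ h₀ alternatingHagg k i j ∈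
        {q : EuclideanSpace ℝ (Fin 3) | q ∈ fccStacking a₀ h₀ ∧ q ≠ 0 ∧ ‖q‖ < 13 / 10 * a₀} := by
    intro k i j hk hm
    refine ⟨?_, hm.2.1, hm.2.2⟩
    rw [hcf i j k hk]
    exact barlowPos_mem _ _ _
  have m1 := memH 0 1 0 (by omega) (by omega)
  have m2 := memH 0 0 1 (by omega) (by omega)
  have m3 := memH 1 0 0 (by omega) (by omega)
  refine ⟨linearIndependent_frame ha0.ne' hh0.ne', ?_, ?_⟩
  · intro i
    fin_cases i
    · exact m1
    · exact m2
    · exact m3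
  · intro i
    fin_cases i
    · exact memF 0 1 0 (Or.inl rfl) m1
    · exact memF 0 0 1 (Or.inl rfl) m2
    · exact memF 1 0 0 (Or.inr rfl) m3

/-- **Stub S2 of the line `blowup-slot-layering` (registered signature, verbatim): `∀ η > 0`-goodness is
exactness.** A point of a `δ`-separated set that is `η`-good for every `η > 0` has an EXACT template shell
(two-letter twin of `ExactHcpLocal.exact_cluster`; `δ`-separation is not needed). [folklore] -/
theorem stub_exactOfForallGood : ∀ (a₀ h₀ δ : ℝ), 47 / 50 ≤ a₀ → a₀ ≤ 1 → |h₀ - a₀ * Real.sqrt (2 / 3)| ≤ a₀ / 100 → 0 < δ → ∀ (Y : Set (EuclideanSpace ℝ (Fin 3))), (∀ p ∈ Y, ∀ q ∈ Y, p ≠ q → δ ≤ dist p q) → ∀ p ∈ Y, (∀ η : ℝ, 0 < η → (∃ A : EuclideanSpace ℝ (Fin 3) →ₗᵢ[ℝ] EuclideanSpace ℝ (Fin 3), (∃ e : ↥{z : EuclideanSpace ℝ (Fin 3) | z ∈ Y ∧ z ≠ p ∧ dist z p < 13 / 10 * a₀} ≃ ↥{q : EuclideanSpace ℝ (Fin 3)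 | q ∈ Literature.MathematicalPhysics.StatisticalMechanics.hcpStacking a₀ h₀ ∧ q ≠ 0 ∧ ‖q‖ < 13 / 10 * a₀}, ∀ t : ↥{z : EuclideanSpace ℝ (Fin 3) | z ∈ Y ∧ z ≠ p ∧ dist z p < 13 / 10 * a₀}, dist ((t : EuclideanSpace ℝ (Fin 3)) - p) (A ((e t : ↥{q : EuclideanSpace ℝ (Fin 3) | q ∈ Literature.MathematicalPhysics.StatisticalMechanics.hcpStacking a₀ h₀ ∧ q ≠ 0 ∧ ‖q‖ < 13 / 10 * a₀}) : EuclideanSpace ℝ (Fin 3))) ≤ η) ∨ (∃ e : ↥{z : EuclideanSpace ℝ (Fin 3) | z ∈ Y ∧ z ≠ p ∧ dist z p < 13 / 10 * a₀} ≃ ↥{q : EuclideanSpace ℝ (Fin 3) | q ∈ Literature.MathematicalPhysics.StatisticalMechanics.fccStacking a₀ h₀ ∧ q ≠ 0 ∧ ‖q‖ < 13 / 10 * a₀}, ∀ t : ↥{z : EuclideanSpace ℝ (Fin 3) | z ∈ Y ∧ z ≠ p ∧ dist z p < 13 / 10 * a₀}, dist ((t : EuclideanSpace ℝ (Fin 3))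 - p) (A ((e t : ↥{q : EuclideanSpace ℝ (Fin 3) | q ∈ Literature.MathematicalPhysics.StatisticalMechanics.fccStacking a₀ h₀ ∧ q ≠ 0 ∧ ‖q‖ < 13 / 10 * a₀}) : EuclideanSpace ℝ (Fin 3))) ≤ η))) → (∃ A : EuclideanSpace ℝ (Fin 3) →ₗᵢ[ℝ] EuclideanSpace ℝ (Fin 3), {z : EuclideanSpace ℝ (Fin 3) | z ∈ Y ∧ z ≠ p ∧ dist z p < 13 / 10 * a₀} = (fun q => p + A q) '' {q : EuclideanSpace ℝ (Fin 3) | q ∈ Literature.MathematicalPhysics.StatisticalMechanics.hcpStacking a₀ h₀ ∧ q ≠ 0 ∧ ‖q‖ < 13 / 10 * a₀} ∨ {z : EuclideanSpace ℝ (Fin 3) | z ∈ Y ∧ z ≠ p ∧ dist z p < 13 / 10 * a₀} = (fun q => p + A q) '' {q : EuclideanSpace ℝ (Fin 3) | q ∈ Literature.MathematicalPhysics.StatisticalMechanics.fccStacking a₀ h₀ ∧ q ≠ 0 ∧ ‖q‖ < 13 / 10 * a₀}) := by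
  classical
  intro a₀ h₀ _ ha _ hh _ Y _ p _ hgood
  obtain ⟨ha0, hlo, -⟩ := inBox_bounds ha hh
  have hh0 : 0 < h₀ := by linarith
  have hr : (0 : ℝ) < 13 / 10 * a₀ := by positivity
  obtain ⟨hf, hfH, hfF⟩ := frame_mem_shells ha hh
  have hfinH : ({q : EuclideanSpace ℝ (Fin 3) |
      q ∈ hcpStacking a₀ h₀ ∧ q ≠ 0 ∧ ‖q‖ < 13 / 10 * a₀}).Finite :=
    barlowShell_finite ha0 hh0 alternatingHagg _
  have hfinF : ({q : EuclideanSpace ℝ (Fin 3) |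
      q ∈ fccStacking a₀ h₀ ∧ q ≠ 0 ∧ ‖q‖ < 13 / 10 * a₀}).Finite :=
    barlowShell_finite ha0 hh0 constHagg _
  have hTr : ∀ t ∈ {z : EuclideanSpace ℝ (Fin 3) | z ∈ Y ∧ z ≠ p ∧ dist z p < 13 / 10 * a₀},
      dist t p < 13 / 10 * a₀ := fun t ht => ht.2.2
  -- one letter for every tolerance (congruence is monotone in the tolerance)
  by_cases hH : ∀ η : ℝ, 0 < η → ∃ A : EuclideanSpace ℝ (Fin 3) →ₗᵢ[ℝ] EuclideanSpace ℝ (Fin 3),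
      ∃ e : ↥{z : EuclideanSpace ℝ (Fin 3) | z ∈ Y ∧ z ≠ p ∧ dist z p < 13 / 10 * a₀} ≃
        ↥{q : EuclideanSpace ℝ (Fin 3) | q ∈ hcpStacking a₀ h₀ ∧ q ≠ 0 ∧ ‖q‖ < 13 / 10 * a₀},
        ∀ t : ↥{z : EuclideanSpace ℝ (Fin 3) | z ∈ Y ∧ z ≠ p ∧ dist z p < 13 / 10 * a₀},
          dist ((t : EuclideanSpace ℝ (Fin 3)) - p)
            (A ((e t : ↥{q : EuclideanSpace ℝ (Fin 3) |
              q ∈ hcpStacking a₀ h₀ ∧ q ≠ 0 ∧ ‖q‖ < 13 / 10 * a₀}) : EuclideanSpace ℝ (Fin 3))) ≤ η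
  · obtain ⟨B, hB⟩ := shell_eq_image_of_forall_eta hfinH hr hTr (fun q hq => hq.2.2) _ hf hfH hH
    exact ⟨B, Or.inl hB⟩
  · push Not at hH
    obtain ⟨η₁, hη₁, h1⟩ := hH
    have hF : ∀ η : ℝ, 0 < η → ∃ A : EuclideanSpace ℝ (Fin 3) →ₗᵢ[ℝ] EuclideanSpace ℝ (Fin 3),
        ∃ e : ↥{z : EuclideanSpace ℝ (Fin 3) | z ∈ Y ∧ z ≠ p ∧ dist z p < 13 / 10 * a₀} ≃
          ↥{q : EuclideanSpace ℝ (Fin 3) | q ∈ fccStacking a₀ h₀ ∧ q ≠ 0 ∧ ‖q‖ < 13 / 10 * a₀},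
          ∀ t : ↥{z : EuclideanSpace ℝ (Fin 3) | z ∈ Y ∧ z ≠ p ∧ dist z p < 13 / 10 * a₀},
            dist ((t : EuclideanSpace ℝ (Fin 3)) - p)
              (A ((e t : ↥{q : EuclideanSpace ℝ (Fin 3) |
                q ∈ fccStacking a₀ h₀ ∧ q ≠ 0 ∧ ‖q‖ < 13 / 10 * a₀}) : EuclideanSpace ℝ (Fin 3))) ≤ η := by
      intro η hη
      obtain ⟨A, hA | hA⟩ := hgood (min η₁ η) (lt_min hη₁ hη)
      · obtain ⟨e, he⟩ := hA
        obtain ⟨t, ht⟩ := h1 A e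
        exact absurd ((he t).trans (min_le_left _ _)) (not_le.2 ht)
      · obtain ⟨e, he⟩ := hA
        exact ⟨A, e, fun t => (he t).trans (min_le_right _ _)⟩
    obtain ⟨B, hB⟩ := shell_eq_image_of_forall_eta hfinF hr hTr (fun q hq => hq.2.2) _ hf hfF hF
    exact ⟨B, Or.inr hB⟩

end Summit.AtomisticToContinuum.Crystallization.Theorems.ShellsToLayers

end
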